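import Summits.AtomisticToContinuum.Crystallization.Theorems.FrustratedLawDichotomyStrainedPatchIndexNetsA

/-!
# «IndexNets» (lens-5 g65 addenda 4+5, 27623 T-side: symbolic lattice vectors, index nets / operator-ball boxes / data-level goodness, the five NetGood clauses from GoodData, satisfiability of the data-level hypotheses on the whole symmetric quarter window (protocol V2 (a))) — part 2 of 2 (sequel of `…FrustratedLawDichotomyStrainedPatchIndexNetsA`)

Split for the 400-line cap by the landing lane (hand-2 g30); the module docstring of part 1 (`…FrustratedLawDichotomyStrainedPatchIndexNetsA`) describes the whole node.  Same namespace; all FQNs unchanged.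
0 sorry; standard axioms.
-/

noncomputable section

namespace Summit.AtomisticToContinuum.Crystallization.Theorems.FrustratedLawDichotomyStrainedPatchIndexNets

open scoped BigOperators Classical RealInnerProductSpace
open Literature.Geometry.DiscreteGeometry (fccKissingPattern hcpKissingPattern card_fccKissingPattern card_hcpKissingPattern
  norm_eq_one_of_mem_fccKissingPattern norm_eq_one_of_mem_hcpKissingPattern one_le_dist_of_mem_fccKissingPattern one_le_dist_of_mem_hcpKissingPattern)
open Summit.AtomisticToContinuum.Crystallization.Theorems.FrustratedLawDichotomyPeriodicBlockFlags (goodAtScale_mono)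
open Summit.AtomisticToContinuum.Crystallization.Theorems.FrustratedLawDichotomyRangeCut (Sep)
open Summit.AtomisticToContinuum.Crystallization.Theorems.FrustratedLawDichotomyMotifLemmas
open Summit.AtomisticToContinuum.Crystallization.Theorems.FrustratedLawDichotomyAveragingCut
open Summit.AtomisticToContinuum.Crystallization.Theorems.FrustratedLawDichotomyAveragingRuleCap
open Summit.AtomisticToContinuum.Crystallization.Theorems.FrustratedLawDichotomyAveragingRuleTightFree
open Summit.AtomisticToContinuum.Crystallization.Theorems.FrustratedLawDichotomyExemptDoor (SitePred)
open Summit.AtomisticToContinuum.Crystallization.Theorems.FrustratedLawDichotomyExemptAbsorption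
open Summit.AtomisticToContinuum.Crystallization.Theorems.FrustratedLawDichotomyExemptAbsorptionRecord
open Summit.AtomisticToContinuum.Crystallization.Theorems.FrustratedLawDichotomyCollarCensus
open Summit.AtomisticToContinuum.Crystallization.Theorems.FrustratedLawDichotomyCollarCensusKappa
open Summit.AtomisticToContinuum.Crystallization.Theorems.FrustratedLawDichotomyStrainedPatchHomSplit
open Summit.AtomisticToContinuum.Crystallization.Theorems.FrustratedLawDichotomyStrainedPatchCleanCollar
open Summit.AtomisticToContinuum.Crystallization.Theorems.FrustratedLawDichotomyStrainedPatchHomTube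
open Summit.AtomisticToContinuum.Crystallization.Theorems.FrustratedLawDichotomyStrainedPatchHomPolar
open Summit.AtomisticToContinuum.Crystallization.Theorems.FrustratedLawDichotomyStrainedPatchHomIsometry
open Summit.AtomisticToContinuum.Crystallization.Theorems.FrustratedLawDichotomyStrainedPatchHomTubeIso
open Summit.AtomisticToContinuum.Crystallization.Theorems.FrustratedLawDichotomyStrainedPatchPhaseCut
open Summit.AtomisticToContinuum.Crystallization.Theorems.FrustratedLawDichotomyStrainedPatchCoreTube
open Summit.AtomisticToContinuum.Crystallization.Theorems.FrustratedLawDichotomyStrainedPatchCoreTubeRecord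
open Summit.AtomisticToContinuum.Crystallization.Theorems.FrustratedLawDichotomyStrainedPatchCoreTubeMilli
open Summit.AtomisticToContinuum.Crystallization.Theorems.FrustratedLawDichotomyStrainedPatchStrainBands
open Summit.AtomisticToContinuum.Crystallization.Theorems.FrustratedLawDichotomyStrainedPatchChartFamilies
open Summit.AtomisticToContinuum.Crystallization.Theorems.FrustratedLawDichotomyStrainedPatchChartFamiliesBent
open Summit.AtomisticToContinuum.Crystallization.Theorems.FrustratedLawDichotomyStrainedPatchChartFamiliesPinned
open Summit.AtomisticToContinuum.Crystallization.Theorems.FrustratedLawDichotomyStrainedPatchRecutPairs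
open Summit.AtomisticToContinuum.Crystallization.Theorems.FrustratedLawDichotomyStrainedPatchRecutKinematics
open Summit.AtomisticToContinuum.Crystallization.Theorems.FrustratedLawDichotomyStrainedPatchWindowFamilies
open Summit.AtomisticToContinuum.Crystallization.Theorems.FrustratedLawDichotomyStrainedPatchHostCells
open Summit.AtomisticToContinuum.Crystallization.Theorems.FrustratedLawDichotomyStrainedPatchGaugeCells
open Summit.AtomisticToContinuum.Crystallization.Theorems.FrustratedLawDichotomyStrainedPatchHomLatticeBox
open Summit.AtomisticToContinuum.Crystallization.Theorems.FrustratedLawDichotomyStrainedPatchHomLatticeBoxHcp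
open Literature.Barriers.AtomisticToContinuum.FlatleyTheil2015 (fccVec fccPoint norm_fccPoint_sq)
open Summit.AtomisticToContinuum.Crystallization.Theorems.FrustratedLawDichotomyStrainedPatchHomRelief (latPt_fccVec_eq)
open Summit.AtomisticToContinuum.Crystallization.Theorems.FrustratedLawDichotomyStrainedPatchTaylorLattice (norm_apply_le_of_near_one)

/-! ## §4. SATISFIABILITY of the data-level hypotheses on the WHOLE symmetric quarter window (critic row 1116, protocol V2 (a))

The hypotheses `∀ k, N.GoodData k (U₀ k) (r k)` of `netGood_clauses_of_goodData` and the ball-cover hypothesis of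
`boxesCoverW_clauses_of_ballCover` are JOINTLY satisfiable: a finite `1/10`-net of the compact operator ball `‖U − 1‖ ≤ 1/4` (both branches), each box
listed by the STANDARD LISTING `{(n, s) admissible : n ∈ [−25, 25]³, ‖U₀ (nomVec φ n s)‖ ≤ 12}`, is good box by box (`stdNet_goodData`: listed vectors have
`‖w‖ ≤ 16`, so `12 + 1.6 + 5/16 ≤ 14`; an admissible unlisted `(n, s)` has `‖U₀ w‖ > 12` — if `‖U₀ w‖ ≤ 12` then `‖w‖ ≤ 16` puts `n` in the box — and then
`10 + 5/16 + ‖w‖/10 < ‖U₀ w‖` in both regimes `‖w‖ ≤ 33/2`, `‖w‖ > 33/2`).  Consequence (HOME glue file, kernel-checked): the rev-3 structural hypotheses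
`NetGood φ R c P ∧ BoxesCoverW φ P WSym` of `tubeP_of_frameNet_WSym` are inhabited — the corner clash of rev 2 cannot recur. -/

section Sat

/-- The integer index box `[−25, 25]³` (as a `Set`: membership is a plain `∀`, nothing to evaluate). -/
def box25 : Set (Fin 3 → ℤ) := {n | ∀ i, n i ∈ Set.Icc (-25 : ℤ) 25}

/-- The box is finite. [formal bookkeeping] -/
theorem box25_finite : box25.Finite :=
  (Set.Finite.pi fun _ : Fin 3 => Set.finite_Icc (-25 : ℤ) 25).subset fun _ hn => Set.mem_univ_pi.2 hn

/-- Real bounds `−26 < nᵢ < 26` put an index in the box. [formal bookkeeping] -/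
theorem mem_box25_of_bounds {n : Fin 3 → ℤ} (h : ∀ i, ((n i : ℤ) : ℝ) < 26 ∧ (-26 : ℝ) < n i) : n ∈ box25 := fun i => by
  obtain ⟨h1, h2⟩ := h i
  have h1' : n i < 26 := by exact_mod_cast h1
  have h2' : -26 < n i := by exact_mod_cast h2
  exact Set.mem_Icc.2 ⟨by omega, by omega⟩

/-- fcc: `‖P n‖ ≤ 16 ⟹ n ∈ [−25, 25]³` (`S = (n₂+n₃)² + (n₁+n₃)² + (n₁+n₂)² = 2‖P n‖² ≤ 512` and `4nᵢ² ≤ 3S`). [folklore] -/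
theorem mem_box25_fcc {n : Fin 3 → ℤ} (h : ‖latPt 1 fccVec n‖ ≤ 16) : n ∈ box25 := by
  rw [latPt_fccVec_eq, one_apply_eq_self] at h
  have hn := norm_nonneg (fccPoint n)
  have hsq : ‖fccPoint n‖ ^ 2 ≤ 256 := by nlinarith
  rw [norm_fccPoint_sq] at hsq
  have hS : ((((n 1 + n 2) ^ 2 + (n 0 + n 2) ^ 2 + (n 0 + n 1) ^ 2 : ℤ)) : ℝ) ≤ 512 := by linarith
  have hSZ : (n 1 + n 2) ^ 2 + (n 0 + n 2) ^ 2 + (n 0 + n 1) ^ 2 ≤ (512 : ℤ) := by exact_mod_cast hS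
  have h0 : 4 * (n 0) ^ 2 ≤ 3 * ((n 1 + n 2) ^ 2 + (n 0 + n 2) ^ 2 + (n 0 + n 1) ^ 2) := by
    nlinarith [sq_nonneg (n 1 - n 2), sq_nonneg (n 0 + 2 * n 1 + n 2), sq_nonneg (n 0 + n 1 + 2 * n 2)]
  have h1 : 4 * (n 1) ^ 2 ≤ 3 * ((n 1 + n 2) ^ 2 + (n 0 + n 2) ^ 2 + (n 0 + n 1) ^ 2) := by
    nlinarith [sq_nonneg (n 0 - n 2), sq_nonneg (n 1 + 2 * n 0 + n 2), sq_nonneg (n 1 + n 0 + 2 * n 2)]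
  have h2 : 4 * (n 2) ^ 2 ≤ 3 * ((n 1 + n 2) ^ 2 + (n 0 + n 2) ^ 2 + (n 0 + n 1) ^ 2) := by
    nlinarith [sq_nonneg (n 1 - n 0), sq_nonneg (n 2 + 2 * n 1 + n 0), sq_nonneg (n 2 + n 1 + 2 * n 0)]
  have hb0 : (n 0) ^ 2 ≤ 384 := by omega
  have hb1 : (n 1) ^ 2 ≤ 384 := by omega
  have hb2 : (n 2) ^ 2 ≤ 384 := by omega
  have habs : ∀ m : ℤ, m ^ 2 ≤ 384 → -25 ≤ m ∧ m ≤ 25 := fun m hm => by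
    constructor <;> nlinarith [sq_nonneg (m + 25), sq_nonneg (m - 25)]
  intro i
  fin_cases i
  · exact Set.mem_Icc.2 (habs _ hb0)
  · exact Set.mem_Icc.2 (habs _ hb1)
  · exact Set.mem_Icc.2 (habs _ hb2)

/-- hcp, unshifted: `‖P n‖ ≤ 16 ⟹ n ∈ [−25, 25]³` (`¾nᵢ² ≤ n₁² + n₁n₂ + n₂²`, `(8/3)n₃² ≤ ‖P n‖²`). [folklore] -/
theorem mem_box25_hex {n : Fin 3 → ℤ} (h : ‖latPt 1 hexFrame n‖ ≤ 16) : n ∈ box25 := by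
  have hn := norm_nonneg (latPt 1 hexFrame n)
  have hsq : ‖latPt 1 hexFrame n‖ ^ 2 ≤ 256 := by nlinarith
  rw [norm_sq_hexPt] at hsq
  have h0u : ((n 0 : ℤ) : ℝ) < 26 := by
    nlinarith [sq_nonneg (((n 0 : ℤ) : ℝ) / 2 + n 1), sq_nonneg ((n 2 : ℤ) : ℝ), sq_nonneg (((n 0 : ℤ) : ℝ) - 26)]
  have h0l : (-26 : ℝ) < n 0 := by
    nlinarith [sq_nonneg (((n 0 : ℤ) : ℝ) / 2 + n 1), sq_nonneg ((n 2 : ℤ) : ℝ), sq_nonneg (((n 0 : ℤ) : ℝ) + 26)]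
  have h1u : ((n 1 : ℤ) : ℝ) < 26 := by
    nlinarith [sq_nonneg (((n 0 : ℤ) : ℝ) + n 1 / 2), sq_nonneg ((n 2 : ℤ) : ℝ), sq_nonneg (((n 1 : ℤ) : ℝ) - 26)]
  have h1l : (-26 : ℝ) < n 1 := by
    nlinarith [sq_nonneg (((n 0 : ℤ) : ℝ) + n 1 / 2), sq_nonneg ((n 2 : ℤ) : ℝ), sq_nonneg (((n 1 : ℤ) : ℝ) + 26)]
  have h2u : ((n 2 : ℤ) : ℝ) < 26 := by
    nlinarith [sq_nonneg (((n 0 : ℤ) : ℝ) + n 1 / 2), sq_nonneg ((n 1 : ℤ) : ℝ), sq_nonneg (((n 2 : ℤ) : ℝ) - 26)]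
  have h2l : (-26 : ℝ) < n 2 := by
    nlinarith [sq_nonneg (((n 0 : ℤ) : ℝ) + n 1 / 2), sq_nonneg ((n 1 : ℤ) : ℝ), sq_nonneg (((n 2 : ℤ) : ℝ) + 26)]
  refine mem_box25_of_bounds fun i => ?_
  fin_cases i
  · exact ⟨h0u, h0l⟩
  · exact ⟨h1u, h1l⟩
  · exact ⟨h2u, h2l⟩

/-- hcp, shifted: `‖P n + hcpShift‖ ≤ 16 ⟹ n ∈ [−25, 25]³` (`u = n₁ + 1/3`, `w = n₂ + 1/3`: `‖P n + s‖² = u² + uw + w² + (8/3)(n₃ + 1/2)²`). [folklore] -/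
theorem mem_box25_hex_shift {n : Fin 3 → ℤ} (h : ‖latPt 1 hexFrame n + hcpShift‖ ≤ 16) : n ∈ box25 := by
  have hn := norm_nonneg (latPt 1 hexFrame n + hcpShift)
  have hsq : ‖latPt 1 hexFrame n + hcpShift‖ ^ 2 ≤ 256 := by nlinarith
  rw [norm_sq_hexPt_add_shift] at hsq
  have h0u : ((n 0 : ℤ) : ℝ) < 26 := by
    nlinarith [sq_nonneg ((((n 0 : ℤ) : ℝ) + 1 / 3) / 2 + (n 1 + 1 / 3)), sq_nonneg (((n 2 : ℤ) : ℝ) + 1 / 2), sq_nonneg (((n 0 : ℤ) : ℝ) - 26)]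
  have h0l : (-26 : ℝ) < n 0 := by
    nlinarith [sq_nonneg ((((n 0 : ℤ) : ℝ) + 1 / 3) / 2 + (n 1 + 1 / 3)), sq_nonneg (((n 2 : ℤ) : ℝ) + 1 / 2), sq_nonneg (((n 0 : ℤ) : ℝ) + 26)]
  have h1u : ((n 1 : ℤ) : ℝ) < 26 := by
    nlinarith [sq_nonneg (((n 0 : ℤ) : ℝ) + n 1 / 2 + 1 / 2), sq_nonneg (((n 2 : ℤ) : ℝ) + 1 / 2), sq_nonneg (((n 1 : ℤ) : ℝ) - 26)]
  have h1l : (-26 : ℝ) < n 1 := by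
    nlinarith [sq_nonneg (((n 0 : ℤ) : ℝ) + n 1 / 2 + 1 / 2), sq_nonneg (((n 2 : ℤ) : ℝ) + 1 / 2), sq_nonneg (((n 1 : ℤ) : ℝ) + 26)]
  have h2u : ((n 2 : ℤ) : ℝ) < 26 := by
    nlinarith [sq_nonneg (((n 0 : ℤ) : ℝ) + n 1 / 2 + 1 / 2), sq_nonneg (((n 1 : ℤ) : ℝ) + 1 / 3), sq_nonneg (((n 2 : ℤ) : ℝ) - 26)]
  have h2l : (-26 : ℝ) < n 2 := by
    nlinarith [sq_nonneg (((n 0 : ℤ) : ℝ) + n 1 / 2 + 1 / 2), sq_nonneg (((n 1 : ℤ) : ℝ) + 1 / 3), sq_nonneg (((n 2 : ℤ) : ℝ) + 26)]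
  refine mem_box25_of_bounds fun i => ?_
  fin_cases i
  · exact ⟨h0u, h0l⟩
  · exact ⟨h1u, h1l⟩
  · exact ⟨h2u, h2l⟩

/-- `nomVec φ 0 false = 0`. [formal bookkeeping] -/
theorem nomVec_zero_false (φ : Bool) : nomVec φ 0 false = 0 := by
  cases φ <;> simp [nomVec, latPt_zero]

/-- ★ Admissible nominal vectors of norm `≤ 16` have their index in `[−25, 25]³` (all three families). [folklore] -/
theorem mem_box25_of_norm_nomVec_le {φ : Bool} {n : Fin 3 → ℤ} {s : Bool} (hs : φ = true → s = false) (h : ‖nomVec φ n s‖ ≤ 16) :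
    n ∈ box25 := by
  cases φ
  · cases s
    · exact mem_box25_hex (by simpa [nomVec] using h)
    · exact mem_box25_hex_shift (by simpa [nomVec] using h)
  · cases s
    · exact mem_box25_fcc (by simpa [nomVec] using h)
    · exact absurd (hs rfl) (by decide)

/-- **The standard listing set** of a box centre `V` on branch `φ`: admissible `(n, s)` with `n ∈ [−25, 25]³` and `‖V (nomVec φ n s)‖ ≤ 12`. -/
def stdSet (φ : Bool) (V : E3 →L[ℝ] E3) : Set ((Fin 3 → ℤ) × Bool) :=
  {p | p.1 ∈ box25 ∧ (φ = true → p.2 = false) ∧ ‖V (nomVec φ p.1 p.2)‖ ≤ 12}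

/-- The standard listing set is finite (it sits inside the box `× Bool`). [formal bookkeeping] -/
theorem stdSet_finite (φ : Bool) (V : E3 →L[ℝ] E3) : (stdSet φ V).Finite :=
  (box25_finite.prod (Set.finite_univ : (Set.univ : Set Bool).Finite)).subset fun _ hp => Set.mk_mem_prod hp.1 (Set.mem_univ _)

/-- The standard listing as a `Finset`. -/
noncomputable def stdFin (φ : Bool) (V : E3 →L[ℝ] E3) : Finset ((Fin 3 → ℤ) × Bool) := (stdSet_finite φ V).toFinset

/-- `mem_stdFin` (docstring added by the landing lane; see the module docstring). [formal bookkeeping] -/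
theorem mem_stdFin {φ : Bool} {V : E3 →L[ℝ] E3} {p : (Fin 3 → ℤ) × Bool} :
    p ∈ stdFin φ V ↔ p.1 ∈ box25 ∧ (φ = true → p.2 = false) ∧ ‖V (nomVec φ p.1 p.2)‖ ≤ 12 :=
  (stdSet_finite φ V).mem_toFinset

/-- `(0, false)` is always listed. [formal bookkeeping] -/
theorem zero_mem_stdFin (φ : Bool) (V : E3 →L[ℝ] E3) : ((0 : Fin 3 → ℤ), false) ∈ stdFin φ V := by
  refine mem_stdFin.2 ⟨?_, fun _ => rfl, ?_⟩
  · exact fun i => Set.mem_Icc.2 ⟨by simp, by simp⟩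
  · rw [nomVec_zero_false, map_zero, norm_zero]; norm_num

/-- Number of listed sites of the standard listing. -/
noncomputable def stdM (φ : Bool) (V : E3 →L[ℝ] E3) : ℕ := (stdFin φ V).card

/-- The standard listing, enumerated. -/
noncomputable def stdEnum (φ : Bool) (V : E3 →L[ℝ] E3) : Fin (stdM φ V) → (Fin 3 → ℤ) × Bool :=
  fun a => (((stdFin φ V).equivFin.symm a : stdFin φ V) : (Fin 3 → ℤ) × Bool)

/-- The centre label of the standard listing (the position of `(0, false)`). -/
noncomputable def stdCentre (φ : Bool) (V : E3 →L[ℝ] E3) : Fin (stdM φ V) :=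
  (stdFin φ V).equivFin ⟨((0 : Fin 3 → ℤ), false), zero_mem_stdFin φ V⟩

/-- `stdEnum_centre` (docstring added by the landing lane; see the module docstring). [formal bookkeeping] -/
theorem stdEnum_centre (φ : Bool) (V : E3 →L[ℝ] E3) : stdEnum φ V (stdCentre φ V) = (0, false) := by
  simp [stdEnum, stdCentre]

/-- `stdEnum_mem` (docstring added by the landing lane; see the module docstring). [formal bookkeeping] -/
theorem stdEnum_mem (φ : Bool) (V : E3 →L[ℝ] E3) (a : Fin (stdM φ V)) : stdEnum φ V a ∈ stdFin φ V :=
  ((stdFin φ V).equivFin.symm a).2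

/-- `stdEnum_injective` (docstring added by the landing lane; see the module docstring). [formal bookkeeping] -/
theorem stdEnum_injective (φ : Bool) (V : E3 →L[ℝ] E3) : Function.Injective (stdEnum φ V) :=
  Subtype.val_injective.comp (stdFin φ V).equivFin.symm.injective

/-- `exists_stdEnum_eq` (docstring added by the landing lane; see the module docstring). [formal bookkeeping] -/
theorem exists_stdEnum_eq {φ : Bool} {V : E3 →L[ℝ] E3} {p : (Fin 3 → ℤ) × Bool} (hp : p ∈ stdFin φ V) : ∃ a, stdEnum φ V a = p :=
  ⟨(stdFin φ V).equivFin ⟨p, hp⟩, by simp [stdEnum]⟩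

/-- **The standard index net** over branches `φ` and box centres `V`. -/
noncomputable def stdNet {K : ℕ} (φ : Fin K → Bool) (V : Fin K → E3 →L[ℝ] E3) : IdxNet K where
  φ := φ
  M := fun k => stdM (φ k) (V k)
  idx := fun k a => (stdEnum (φ k) (V k) a).1
  sub := fun k a => (stdEnum (φ k) (V k) a).2
  c := fun k => stdCentre (φ k) (V k)

/-- ★★ **Every box of the standard net whose centre lies in the quarter window is GOOD at radius `1/10`.** [PROVED · the per-box satisfiability of
`GoodData` for EVERY admissible centre, both branches] -/
theorem stdNet_goodData {K : ℕ} (φ : Fin K → Bool) (V : Fin K → E3 →L[ℝ] E3) (k : Fin K) (hV : ‖V k - 1‖ ≤ 1 / 4) :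
    (stdNet φ V).GoodData k (V k) (1 / 10) := by
  refine ⟨by norm_num, fun hφ a => ?_, fun a a' hidx hsub => ?_, ?_, ?_, fun a => ?_, fun n s hs => ?_⟩
  · exact (mem_stdFin.1 (stdEnum_mem (φ k) (V k) a)).2.1 hφ
  · exact stdEnum_injective (φ k) (V k) (Prod.ext hidx hsub)
  · show (stdEnum (φ k) (V k) (stdCentre (φ k) (V k))).1 = 0
    rw [stdEnum_centre]
  · show (stdEnum (φ k) (V k) (stdCentre (φ k) (V k))).2 = false
    rw [stdEnum_centre]
  · have h12 := (mem_stdFin.1 (stdEnum_mem (φ k) (V k) a)).2.2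
    have hge := norm_apply_ge_of_near_one hV (nomVec (φ k) (stdEnum (φ k) (V k) a).1 (stdEnum (φ k) (V k) a).2)
    show ‖V k (nomVec (φ k) (stdEnum (φ k) (V k) a).1 (stdEnum (φ k) (V k) a).2)‖ +
        1 / 10 * ‖nomVec (φ k) (stdEnum (φ k) (V k) a).1 (stdEnum (φ k) (V k) a).2‖ + 5 / 16 ≤ 14
    linarith
  · by_cases hmem : (n, s) ∈ stdFin (φ k) (V k)
    · obtain ⟨a, ha⟩ := exists_stdEnum_eq hmem
      refine Or.inl ⟨a, ?_, ?_⟩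
      · show (stdEnum (φ k) (V k) a).1 = n
        rw [ha]
      · show (stdEnum (φ k) (V k) a).2 = s
        rw [ha]
    · right
      have hs' : φ k = true → s = false := hs
      have hge := norm_apply_ge_of_near_one hV (nomVec (φ k) n s)
      have h12 : 12 < ‖V k (nomVec (φ k) n s)‖ := by
        rcases le_or_gt ‖V k (nomVec (φ k) n s)‖ 12 with hle | hlt
        · exfalso
          have h16 : ‖nomVec (φ k) n s‖ ≤ 16 := by linarith
          have hbox : n ∈ box25 := mem_box25_of_norm_nomVec_le hs' h16
          have hP : ((n, s) : (Fin 3 → ℤ) × Bool) ∈ stdFin (φ k) (V k) := mem_stdFin.2 ⟨hbox, hs', hle⟩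
          exact hmem hP
        · exact hlt
      show 10 + 5 / 16 + 1 / 10 * ‖nomVec (φ k) n s‖ < ‖V k (nomVec (φ k) n s)‖
      by_cases hw : ‖nomVec (φ k) n s‖ ≤ 33 / 2
      · linarith
      · linarith

/-- ★★★ **JOINT SATISFIABILITY ON THE WHOLE WINDOW** [PROVED · V2 (a) of critic row 1116 for the data-level hypotheses]: there is an index net with
operator-ball boxes such that EVERY box is `GoodData` AND the balls cover the symmetric quarter window on both branches with every offset `‖ξ‖ ≤ 1/4`
in its cell (a finite `1/10`-net of the compact ball `‖U − 1‖ ≤ 1/4` of `E3 →L[ℝ] E3`, standard listings, `Ξ k = univ`).  With §3 this inhabits the rev-3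
`NetGood φ R c P ∧ BoxesCoverW φ P WSym` (HOME glue file G4). -/
theorem exists_goodData_ballCover :
    ∃ (K : ℕ) (N : IdxNet K) (U₀ : Fin K → E3 →L[ℝ] E3) (r : Fin K → ℝ) (Ξ : Fin K → Set E3),
      (∀ k, N.GoodData k (U₀ k) (r k)) ∧
        ∀ (φ' : Bool) (U : E3 →L[ℝ] E3) (ξ : E3), SymOp U → PosOp U → ‖U - 1‖ ≤ 1 / 4 → ‖ξ‖ ≤ 1 / 4 →
          ∃ k, N.φ k = φ' ∧ ‖U - U₀ k‖ ≤ r k ∧ ξ ∈ Ξ k := by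
  obtain ⟨t, hts, htfin, hcov⟩ :=
    finite_cover_balls_of_compact (isCompact_closedBall (1 : E3 →L[ℝ] E3) (1 / 4)) (show (0 : ℝ) < 1 / 10 by norm_num)
  obtain ⟨m, eT⟩ : ∃ m : ℕ, Nonempty (htfin.toFinset ≃ Fin m) := ⟨_, ⟨htfin.toFinset.equivFin⟩⟩
  obtain ⟨eT⟩ := eT
  let enc : Bool × Fin m ≃ Fin (2 * m) := (finTwoEquiv.symm.prodCongr (Equiv.refl (Fin m))).trans finProdFinEquiv
  let φ : Fin (2 * m) → Bool := fun k => (enc.symm k).1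
  let V : Fin (2 * m) → E3 →L[ℝ] E3 := fun k => ((eT.symm (enc.symm k).2 : htfin.toFinset) : E3 →L[ℝ] E3)
  have hV : ∀ k, ‖V k - 1‖ ≤ 1 / 4 := fun k => by
    have hmem : ((eT.symm (enc.symm k).2 : htfin.toFinset) : E3 →L[ℝ] E3) ∈ t := htfin.mem_toFinset.1 (eT.symm (enc.symm k).2).2
    have hball := hts hmem
    rwa [Metric.mem_closedBall, dist_eq_norm] at hball
  refine ⟨2 * m, stdNet φ V, V, fun _ => 1 / 10, fun _ => Set.univ, fun k => stdNet_goodData φ V k (hV k), ?_⟩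
  intro φ' U ξ _ _ hU _
  have hUmem : U ∈ Metric.closedBall (1 : E3 →L[ℝ] E3) (1 / 4) := by rw [Metric.mem_closedBall, dist_eq_norm]; exact hU
  obtain ⟨x, hxt, hUx⟩ := Set.mem_iUnion₂.1 (hcov hUmem)
  have hxT : x ∈ htfin.toFinset := htfin.mem_toFinset.2 hxt
  have hdist : dist U x < 1 / 10 := Metric.mem_ball.1 hUx
  rw [dist_eq_norm] at hdist
  refine ⟨enc (φ', eT ⟨x, hxT⟩), ?_, ?_, Set.mem_univ _⟩
  · show (enc.symm (enc (φ', eT ⟨x, hxT⟩))).1 = φ'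
    rw [Equiv.symm_apply_apply]
  · show ‖U - ((eT.symm (enc.symm (enc (φ', eT ⟨x, hxT⟩))).2 : htfin.toFinset) : E3 →L[ℝ] E3)‖ ≤ 1 / 10
    rw [Equiv.symm_apply_apply, Equiv.symm_apply_apply]
    exact hdist.le

end Sat

end Summit.AtomisticToContinuum.Crystallization.Theorems.FrustratedLawDichotomyStrainedPatchIndexNets
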